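import Summits.RiemannHypothesis.RiemannHypothesis.Theorems.Splittings.JensenX4KiKimLeeChain
import Literature.NumberTheory.LFunctions.DeBruijnNewmanConstProofs

/-!
# Splittings — X-4 × NEWMAN FOR EVERY DERIVATIVE, part 4/4: `{t | H_t^{(m)} hyperbolic} = [λ_m, ∞)` for every `m`; `λ_m → λ_∞`, KKL (ii) typed
# (de Bruijn's universal factors for the derivative kernels; SPLIT-jen-neg gen 6, supplement S2; zero-definition raw form)

Cell rh-split (brief sha16 f79c5f09d8bcb036), seat rh-split-jen-neg g6 (planner-rh-split-jen-neg-g6-0), card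
`run/shared/lean/pub/rh-split/cards/SPLIT-jen-neg.md` ADDENDUM 7 + supplements S1/S2 (lead ruling #42: PRE-FILE OFFER accepted as lane (xvi));
cut by the seat from `HOME/rh-split-jen-neg/g6/SketchG6AllDerivDelta.lean` §G6.10 (declarations byte-identical to it; the seat's combined
file checks rc 0 / 0 warnings / 0 sorries on the farm, standard axioms).  Part 4 of the lane-(xvi) split (parts 1–3:
`Splittings/JensenX4NewmanAllDerivPsi.lean`, `…/JensenX4NewmanAllDeriv.lean`, `…/JensenX4KiKimLeeChain.lean`); same shared namespace
`…Splittings.JensenX4NewmanAllDeriv`.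

Content (`λ_m := sInf {t : ℝ | HasOnlyRealZeros (iteratedDeriv m (deBruijnH t))}`, `F_t = deBruijnKernel t`, de Bruijn's kernel of `2H_t`).
The DERIVATIVE KERNELS `s ↦ F_t(s)(is)^m` are admissible in de Bruijn's sense (`isAdmissible_deBruijnKernel_mul_pow`: integrable,
`F(−s) = F(s)^*`, decay `O(e^{−|s|³})`, from the tree's `exists_norm_deBruijnKernel_le` and `x^m ≤ m!·e^x`) and represent the derivatives,
`trigIntegral_deBruijnKernel_mul_pow : trigIntegral (fun s ↦ F_t s * (I s)^m) = fun z ↦ 2 * iteratedDeriv m (deBruijnH t) z`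
(differentiation under the integral sign, the tree's `hasDerivAt_trigIntegral`, iterated); the universal factor `e^{λ²s²/2}` shifts
`t ↦ t + λ²/2` on them (`deBruijnKernel_mul_pow_mul_gaussian`); hence de Bruijn 1950 Thm. 13 with `Δ = 0`
(`Literature.Analysis.Complex.DeBruijn1950.rootsInStrip_gaussian`) gives the UP-SET property
`hasOnlyRealZeros_iteratedDeriv_mono_t (m) (t₁ ≤ t₂) : HasOnlyRealZeros (iteratedDeriv m (deBruijnH t₁)) → HasOnlyRealZeros (iteratedDeriv m (deBruijnH t₂))`
for EVERY `m` (`m = 0` = the tree's `HasOnlyRealZeros.mono_deBruijnH_holds`), and with part 3's attainment `kiKimLee_const_mem`: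
`hasOnlyRealZeros_iteratedDeriv_iff_kiKimLee_const_le (m t) : HasOnlyRealZeros (iteratedDeriv m (deBruijnH t)) ↔ λ_m ≤ t`,
`setOf_hasOnlyRealZeros_iteratedDeriv_eq_Ici (m) : {t | …} = Set.Ici λ_m`, `not_hasOnlyRealZeros_iteratedDeriv_iff_lt_kiKimLee_const`,
and the `m = 0` sanity `hasOnlyRealZeros_deBruijnH_iff_le : HasOnlyRealZeros (deBruijnH t) ↔ deBruijnNewmanConst ≤ t` (= the tree's
`hasOnlyRealZeros_deBruijnH_iff_deBruijnNewmanConst_le_holds`, re-derived).  So for every derivative order the picture is the tree's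
`m = 0` picture: a closed ray `[λ_m, ∞)` with `0 ≤ ⋯ ≤ λ_2 ≤ λ_1 ≤ λ_0 = Λ < 1/2`.
§G6.11 (supplement S4): the limit constant `λ_∞ := ⨅ m, λ_m` — `tendsto_kiKimLee_const : λ_m → λ_∞`, `0 ≤ λ_∞ ≤ Λ`,
RH ⟹ `λ_∞ = 0` — and Ki–Kim–Lee 2009 (ii) (`lim_m Λ^{(m)} ≤ 0`, Lagarias–Montague arXiv:1106.4348 p. 4) TYPED in zero
language as `∀ t > 0, ∃ m, HasOnlyRealZeros (iteratedDeriv m (deBruijnH t))` (NOT proved: it needs the Pólya–Wiman theorem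
of Craven–Csordas–Smith / Ki–Kim, absent from the tree) and shown equivalent to `λ_∞ = 0`, to `λ_m → 0`
(`forall_pos_exists_hasOnlyRealZeros_iteratedDeriv_iff_tendsto_zero`) and to the uniform form
`∀ ε > 0, ∃ m₀, ∀ m ≥ m₀, ∀ t ≥ ε, H_t^{(m)} hyperbolic` (up-set in `t` + heredity in `m`); RH implies it trivially.

HONEST LABEL: «SPLITTING SEARCH over kernel-typed RH-EQUIVALENCES; a splitting A ∧ B ⟹ RH is CONDITIONAL bookkeeping unless A and B are
both proved; nothing here bears on the truth of RH.»
-/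

set_option linter.dupNamespace false

noncomputable section

open Complex Filter Set Topology Metric

namespace Summit.RiemannHypothesis.RiemannHypothesis.Theorems.Splittings.JensenX4NewmanAllDeriv

open Literature Literature.NumberTheory.LFunctions
open Summit.RiemannHypothesis.RiemannHypothesis.Theorems.Splittings.JensenX4NewmanDeriv

/-! ## G6.10  Monotonicity in `t` (de Bruijn's universal factors for the derivative kernels `F_t(s)(is)^m`) -/

section UpSet

open MeasureTheory Literature.Analysis.Complex Literature.Analysis.Complex.DeBruijn1950

/-- The elementary bound `x^m ≤ m! · e^x` for `x ≥ 0`. -/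
theorem pow_le_factorial_mul_exp (x : ℝ) (hx : 0 ≤ x) (m : ℕ) :
    x ^ m ≤ m.factorial * Real.exp x := by
  have h := Real.pow_div_factorial_le_exp x hx m
  have hf : (0 : ℝ) < m.factorial := by exact_mod_cast m.factorial_pos
  rwa [div_le_iff₀' hf] at h

/-- `|s|^m ≤ m! · e^{|s|³}` for every real `s`. -/
theorem abs_pow_le_factorial_mul_exp_cube (s : ℝ) (m : ℕ) :
    |s| ^ m ≤ m.factorial * Real.exp (|s| ^ 3) := by
  have hf : (1 : ℝ) ≤ m.factorial := by exact_mod_cast m.factorial_pos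
  rcases le_or_gt |s| 1 with h | h
  · calc |s| ^ m ≤ 1 := pow_le_one₀ (abs_nonneg s) h
      _ ≤ m.factorial * Real.exp (|s| ^ 3) := by
          have h1 : (1 : ℝ) ≤ Real.exp (|s| ^ 3) := Real.one_le_exp_iff.2 (pow_nonneg (abs_nonneg s) 3)
          nlinarith
  · calc |s| ^ m ≤ (|s| ^ 3) ^ m := by
          gcongr
          calc |s| = |s| ^ 1 := (pow_one _).symm
            _ ≤ |s| ^ 3 := pow_le_pow_right₀ h.le (by norm_num)
      _ ≤ m.factorial * Real.exp (|s| ^ 3) :=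
          pow_le_factorial_mul_exp _ (pow_nonneg (abs_nonneg s) 3) m

/-- Norm of the derivative kernel: `‖F_t(s) (is)^m‖ = ‖F_t(s)‖ |s|^m`. -/
theorem norm_deBruijnKernel_mul_pow (t s : ℝ) (m : ℕ) :
    ‖deBruijnKernel t s * (I * s) ^ m‖ = ‖deBruijnKernel t s‖ * |s| ^ m := by
  rw [norm_mul, norm_pow, norm_mul, Complex.norm_I, one_mul, Complex.norm_real, Real.norm_eq_abs]

/-- The derivative kernels `F_t(s)(is)^m` are ADMISSIBLE in de Bruijn's sense (integrable, `F(−s) = F(s)^*`,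
decay `O(e^{−|s|³})`), from the tree's bound `‖F_t(s)‖ ≤ C e^{−|s|} e^{−|s|³}` and `x^m ≤ m! e^x`. -/
theorem isAdmissible_deBruijnKernel_mul_pow (t : ℝ) (m : ℕ) :
    IsAdmissible (fun s : ℝ ↦ deBruijnKernel t s * (I * s) ^ m) := by
  obtain ⟨C, hC, hle⟩ := exists_norm_deBruijnKernel_le t
  have hmeas : AEStronglyMeasurable (fun s : ℝ ↦ deBruijnKernel t s * (I * s) ^ m) :=
    ((continuous_deBruijnKernel t).mul (by fun_prop)).aestronglyMeasurable
  refine ⟨?_, fun s ↦ ?_, ?_⟩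
  · -- integrable: `‖F_t(s)(is)^m‖ ≤ C m! e^{−|s|}`
    refine Integrable.mono' (integrable_exp_neg_abs.const_mul (C * m.factorial)) hmeas
      (Eventually.of_forall fun s ↦ ?_)
    rw [norm_deBruijnKernel_mul_pow]
    have h3 := abs_pow_le_factorial_mul_exp_cube s m
    calc ‖deBruijnKernel t s‖ * |s| ^ m
        ≤ (C * Real.exp (-|s|) * Real.exp (-|s| ^ 3)) * (m.factorial * Real.exp (|s| ^ 3)) :=
          mul_le_mul (hle s) h3 (pow_nonneg (abs_nonneg s) m) (by positivity)
      _ = C * m.factorial * Real.exp (-|s|) := by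
          have : Real.exp (-|s| ^ 3) * Real.exp (|s| ^ 3) = 1 := by
            rw [← Real.exp_add, neg_add_cancel, Real.exp_zero]
          calc (C * Real.exp (-|s|) * Real.exp (-|s| ^ 3)) * (m.factorial * Real.exp (|s| ^ 3))
              = C * m.factorial * Real.exp (-|s|) * (Real.exp (-|s| ^ 3) * Real.exp (|s| ^ 3)) := by ring
            _ = C * m.factorial * Real.exp (-|s|) := by rw [this, mul_one]
  · -- conj symmetry
    rw [deBruijnKernel_neg, map_mul, map_pow, map_mul, Complex.conj_I, Complex.conj_ofReal, deBruijnKernel,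
      Complex.conj_ofReal]
    push_cast
    ring
  · -- decay with exponent 3: `‖F_t(s)(is)^m‖ ≤ C m! e^{−|s|³}`
    refine ⟨3, C * m.factorial, by norm_num, Eventually.of_forall fun s ↦ ?_⟩
    rw [norm_deBruijnKernel_mul_pow]
    have h1 := pow_le_factorial_mul_exp |s| (abs_nonneg s) m
    calc ‖deBruijnKernel t s‖ * |s| ^ m
        ≤ (C * Real.exp (-|s|) * Real.exp (-|s| ^ 3)) * (m.factorial * Real.exp |s|) :=
          mul_le_mul (hle s) h1 (pow_nonneg (abs_nonneg s) m) (by positivity)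
      _ = C * m.factorial * Real.exp (-|s| ^ 3) := by
          have : Real.exp (-|s|) * Real.exp |s| = 1 := by
            rw [← Real.exp_add, neg_add_cancel, Real.exp_zero]
          calc (C * Real.exp (-|s|) * Real.exp (-|s| ^ 3)) * (m.factorial * Real.exp |s|)
              = C * m.factorial * Real.exp (-|s| ^ 3) * (Real.exp (-|s|) * Real.exp |s|) := by ring
            _ = C * m.factorial * Real.exp (-|s| ^ 3) := by rw [this, mul_one]
      _ = C * m.factorial * Real.exp (-|s| ^ (3 : ℝ)) := by
          rw [show (3 : ℝ) = ((3 : ℕ) : ℝ) by norm_num, Real.rpow_natCast]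

/-- **`∫_ℝ F_t(s)(is)^m e^{izs} ds = 2 H_t^{(m)}(z)`**: the `m`-th derivative of `H_t` as a trigonometric integral
(differentiation under the integral sign, `hasDerivAt_trigIntegral`, iterated). -/
theorem trigIntegral_deBruijnKernel_mul_pow (t : ℝ) (m : ℕ) :
    trigIntegral (fun s : ℝ ↦ deBruijnKernel t s * (I * s) ^ m) = fun z ↦ 2 * iteratedDeriv m (deBruijnH t) z := by
  induction m with
  | zero =>
    funext z
    simp only [pow_zero, mul_one, iteratedDeriv_zero]
    exact trigIntegral_deBruijnKernel t z
  | succ m ih =>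
    funext z
    have hadm := isAdmissible_deBruijnKernel_mul_pow t m
    have hd := hasDerivAt_trigIntegral hadm.integrable.aestronglyMeasurable hadm.integrable_norm_mul_exp z
    rw [ih] at hd
    have h2 : HasDerivAt (fun z ↦ 2 * iteratedDeriv m (deBruijnH t) z)
        (2 * iteratedDeriv (m + 1) (deBruijnH t) z) z := by
      rw [iteratedDeriv_succ]
      exact ((differentiable_iteratedDeriv_deBruijnH t m z).hasDerivAt).const_mul 2
    have heq := hd.unique h2
    rw [← heq, trigIntegral]
    congr 1
    funext s
    simp only [pow_succ]
    ring

/-- The universal factor shifts the time on the derivative kernels too: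
`F_t(s)(is)^m · e^{λ²s²/2} = F_{t+λ²/2}(s)(is)^m`. -/
theorem deBruijnKernel_mul_pow_mul_gaussian (t lam : ℝ) (m : ℕ) :
    (fun s : ℝ ↦ deBruijnKernel t s * (I * s) ^ m * ((Real.exp (lam ^ 2 * s ^ 2 / 2) : ℝ) : ℂ)) =
      fun s : ℝ ↦ deBruijnKernel (t + lam ^ 2 / 2) s * (I * s) ^ m := by
  funext s
  have h := congrFun (deBruijnKernel_mul_gaussian t lam) s
  rw [← h]
  ring

/-- **MONOTONICITY IN `t` FOR EVERY DERIVATIVE (de Bruijn 1950, Thm. 13 with `Δ = 0`, applied to the admissible kernel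
`F_t(s)(is)^m`; `m = 0` is the tree's `HasOnlyRealZeros.mono_deBruijnH_holds`).** If `H_{t₁}^{(m)}` has only real zeros and
`t₁ ≤ t₂`, then `H_{t₂}^{(m)}` has only real zeros: the sets `{t | H_t^{(m)} hyperbolic}` are UP-SETS.
(`H_{t₂}^{(m)} ≢ 0` by `exists_iteratedDeriv_deBruijnH_ne_zero`, G6.6.) -/
theorem hasOnlyRealZeros_iteratedDeriv_mono_t (m : ℕ) {t₁ t₂ : ℝ} (h12 : t₁ ≤ t₂)
    (h : HasOnlyRealZeros (iteratedDeriv m (deBruijnH t₁))) :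
    HasOnlyRealZeros (iteratedDeriv m (deBruijnH t₂)) := by
  have hne := exists_iteratedDeriv_deBruijnH_ne_zero t₂ m
  set lam : ℝ := Real.sqrt (2 * (t₂ - t₁)) with hlam
  have hlam2 : lam ^ 2 = 2 * (t₂ - t₁) := Real.sq_sqrt (by linarith)
  have ht₂eq : t₁ + lam ^ 2 / 2 = t₂ := by rw [hlam2]; ring
  have hroots : RootsInStrip (trigIntegral fun s : ℝ ↦ deBruijnKernel t₁ s * (I * s) ^ m) 0 := by
    intro z hz
    rw [trigIntegral_deBruijnKernel_mul_pow] at hz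
    have := h z ((mul_eq_zero.1 hz).resolve_left two_ne_zero)
    simp [this]
  have hne' : ∃ z, trigIntegral
      (fun s : ℝ ↦ (deBruijnKernel t₁ s * (I * s) ^ m) * ((Real.exp (lam ^ 2 * s ^ 2 / 2) : ℝ) : ℂ)) z ≠ 0 := by
    obtain ⟨z, hz⟩ := hne
    refine ⟨z, ?_⟩
    rw [deBruijnKernel_mul_pow_mul_gaussian, ht₂eq, trigIntegral_deBruijnKernel_mul_pow]
    exact mul_ne_zero two_ne_zero hz
  have hg := rootsInStrip_gaussian (isAdmissible_deBruijnKernel_mul_pow t₁ m) le_rfl lam hroots hne'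
  rw [deBruijnKernel_mul_pow_mul_gaussian, ht₂eq] at hg
  have hmax : max ((0:ℝ) ^ 2 - lam ^ 2) 0 = 0 := max_eq_right (by rw [hlam2]; nlinarith)
  rw [hmax, Real.sqrt_zero] at hg
  intro z hz
  have h2 : trigIntegral (fun s : ℝ ↦ deBruijnKernel t₂ s * (I * s) ^ m) z = 0 := by
    rw [trigIntegral_deBruijnKernel_mul_pow]
    exact show (2 : ℂ) * iteratedDeriv m (deBruijnH t₂) z = 0 by rw [hz, mul_zero]
  exact abs_nonpos_iff.1 (hg z h2)

/-- **`H_t^{(m)}` is hyperbolic iff `λ_m ≤ t`** — the exact analogue, for every derivative order `m`, of the tree's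
`hasOnlyRealZeros_deBruijnH_iff_deBruijnNewmanConst_le_holds` (`m = 0`): attainment (G6.8, `kiKimLee_const_mem`) and the
up-set property (`hasOnlyRealZeros_iteratedDeriv_mono_t`) one way, `csInf_le` the other. -/
theorem hasOnlyRealZeros_iteratedDeriv_iff_kiKimLee_const_le (m : ℕ) (t : ℝ) :
    HasOnlyRealZeros (iteratedDeriv m (deBruijnH t)) ↔
      sInf {t : ℝ | HasOnlyRealZeros (iteratedDeriv m (deBruijnH t))} ≤ t :=
  ⟨fun h ↦ csInf_le (bddBelow_setOf_hasOnlyRealZeros_iteratedDeriv m) h,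
    fun h ↦ hasOnlyRealZeros_iteratedDeriv_mono_t m h (hasOnlyRealZeros_iteratedDeriv_kiKimLee_const m)⟩

/-- **`{t | H_t^{(m)} hyperbolic} = [λ_m, ∞)`** for every `m`: a closed ray with endpoint `λ_m ∈ [0, Λ]`. -/
theorem setOf_hasOnlyRealZeros_iteratedDeriv_eq_Ici (m : ℕ) :
    {t : ℝ | HasOnlyRealZeros (iteratedDeriv m (deBruijnH t))} =
      Set.Ici (sInf {t : ℝ | HasOnlyRealZeros (iteratedDeriv m (deBruijnH t))}) :=
  Set.ext fun t ↦ hasOnlyRealZeros_iteratedDeriv_iff_kiKimLee_const_le m t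

/-- `¬ (H_t^{(m)} hyperbolic) ↔ t < λ_m`: below `λ_m` every `H_t^{(m)}` has a non-real zero. -/
theorem not_hasOnlyRealZeros_iteratedDeriv_iff_lt_kiKimLee_const (m : ℕ) (t : ℝ) :
    ¬ HasOnlyRealZeros (iteratedDeriv m (deBruijnH t)) ↔
      t < sInf {t : ℝ | HasOnlyRealZeros (iteratedDeriv m (deBruijnH t))} := by
  rw [hasOnlyRealZeros_iteratedDeriv_iff_kiKimLee_const_le, not_le]

/-- Sanity (`m = 0`): the ray description recovers the tree's `H_t hyperbolic ↔ Λ ≤ t`.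
(`private`: a consistency re-derivation of the tree's `hasOnlyRealZeros_deBruijnH_iff_deBruijnNewmanConst_le_holds`, not a new public fact.) -/
private theorem hasOnlyRealZeros_deBruijnH_iff_le (t : ℝ) :
    HasOnlyRealZeros (deBruijnH t) ↔ deBruijnNewmanConst ≤ t := by
  have h := hasOnlyRealZeros_iteratedDeriv_iff_kiKimLee_const_le 0 t
  simpa [iteratedDeriv_zero, deBruijnNewmanConst] using h

end UpSet

/-! ## G6.11  The limit constant `λ_∞ := ⨅_m λ_m` and Ki–Kim–Lee (ii) as a typed residue

`λ_m` is antitone and `≥ 0`, so it converges to `λ_∞ := ⨅ m, λ_m ∈ [0, Λ]`.  Ki–Kim–Lee 2009 (ii)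
(`lim_m Λ^{(m)} ≤ 0`, Lagarias–Montague arXiv:1106.4348 p. 4) is, in zero language, the statement
`∀ t > 0, ∃ m, H_t^{(m)} has only real zeros`; we do NOT prove it (it needs the Pólya–Wiman theorem of
Craven–Csordas–Smith / Ki–Kim, absent from the tree) but TYPE it and show it is equivalent to `λ_∞ = 0`,
to `λ_m → 0`, and to the uniform form `∀ ε > 0, ∃ m₀, ∀ m ≥ m₀, ∀ t ≥ ε, H_t^{(m)} hyperbolic`; RH implies it
trivially (`λ_m = 0` for every `m`).  Nothing here is a claim about the truth of RH. -/

section Limit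

/-- `λ_∞ := ⨅ m, λ_m` is `≥ 0`. -/
theorem iInf_kiKimLee_const_nonneg :
    0 ≤ ⨅ m : ℕ, sInf {t : ℝ | HasOnlyRealZeros (iteratedDeriv m (deBruijnH t))} :=
  le_ciInf fun m ↦ kiKimLee_const_nonneg m

/-- `λ_∞ ≤ λ_m` for every `m`. -/
theorem iInf_kiKimLee_const_le (m : ℕ) :
    (⨅ m : ℕ, sInf {t : ℝ | HasOnlyRealZeros (iteratedDeriv m (deBruijnH t))}) ≤
      sInf {t : ℝ | HasOnlyRealZeros (iteratedDeriv m (deBruijnH t))} :=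
  ciInf_le ⟨0, by rintro _ ⟨k, rfl⟩; exact kiKimLee_const_nonneg k⟩ m

/-- `λ_∞ ≤ Λ < 1/2`. -/
theorem iInf_kiKimLee_const_le_deBruijnNewmanConst :
    (⨅ m : ℕ, sInf {t : ℝ | HasOnlyRealZeros (iteratedDeriv m (deBruijnH t))}) ≤ deBruijnNewmanConst :=
  (iInf_kiKimLee_const_le 0).trans (kiKimLee_const_le_deBruijnNewmanConst 0)

/-- **`λ_m → λ_∞`** (a bounded antitone sequence converges to its infimum). -/
theorem tendsto_kiKimLee_const :
    Tendsto (fun m : ℕ ↦ sInf {t : ℝ | HasOnlyRealZeros (iteratedDeriv m (deBruijnH t))}) atTop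
      (𝓝 (⨅ m : ℕ, sInf {t : ℝ | HasOnlyRealZeros (iteratedDeriv m (deBruijnH t))})) :=
  tendsto_atTop_ciInf kiKimLee_const_antitone ⟨0, by rintro _ ⟨k, rfl⟩; exact kiKimLee_const_nonneg k⟩

/-- RH ⟹ `λ_∞ = 0`. -/
theorem iInf_kiKimLee_const_eq_zero_of_rh (hRH : _root_.RiemannHypothesis) :
    (⨅ m : ℕ, sInf {t : ℝ | HasOnlyRealZeros (iteratedDeriv m (deBruijnH t))}) = 0 :=
  le_antisymm ((iInf_kiKimLee_const_le 0).trans_eq (kiKimLee_const_eq_zero_of_rh hRH 0))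
    iInf_kiKimLee_const_nonneg

/-- **Ki–Kim–Lee (ii), typed: `∀ t > 0, ∃ m, H_t^{(m)} hyperbolic` ⟺ `λ_∞ = 0`.** -/
theorem forall_pos_exists_hasOnlyRealZeros_iteratedDeriv_iff_iInf_eq_zero :
    (∀ t : ℝ, 0 < t → ∃ m : ℕ, HasOnlyRealZeros (iteratedDeriv m (deBruijnH t))) ↔
      (⨅ m : ℕ, sInf {t : ℝ | HasOnlyRealZeros (iteratedDeriv m (deBruijnH t))}) = 0 := by
  have hbdd : BddBelow (Set.range fun m : ℕ ↦
      sInf {t : ℝ | HasOnlyRealZeros (iteratedDeriv m (deBruijnH t))}) :=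
    ⟨0, by rintro _ ⟨k, rfl⟩; exact kiKimLee_const_nonneg k⟩
  constructor
  · intro h
    refine le_antisymm ?_ iInf_kiKimLee_const_nonneg
    by_contra hpos
    push Not at hpos
    set L := ⨅ m : ℕ, sInf {t : ℝ | HasOnlyRealZeros (iteratedDeriv m (deBruijnH t))} with hL
    obtain ⟨m, hm⟩ := h (L / 2) (by positivity)
    have h1 : sInf {t : ℝ | HasOnlyRealZeros (iteratedDeriv m (deBruijnH t))} ≤ L / 2 :=
      (hasOnlyRealZeros_iteratedDeriv_iff_kiKimLee_const_le m (L / 2)).1 hm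
    have h2 := iInf_kiKimLee_const_le m
    linarith
  · intro h t ht
    have hlt : (⨅ m : ℕ, sInf {t : ℝ | HasOnlyRealZeros (iteratedDeriv m (deBruijnH t))}) < t := by
      rw [h]; exact ht
    obtain ⟨m, hm⟩ := exists_lt_of_ciInf_lt hlt
    exact ⟨m, (hasOnlyRealZeros_iteratedDeriv_iff_kiKimLee_const_le m t).2 hm.le⟩

/-- **Ki–Kim–Lee (ii) ⟺ `λ_m → 0`.** -/
theorem forall_pos_exists_hasOnlyRealZeros_iteratedDeriv_iff_tendsto_zero :
    (∀ t : ℝ, 0 < t → ∃ m : ℕ, HasOnlyRealZeros (iteratedDeriv m (deBruijnH t))) ↔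
      Tendsto (fun m : ℕ ↦ sInf {t : ℝ | HasOnlyRealZeros (iteratedDeriv m (deBruijnH t))}) atTop
        (𝓝 0) := by
  rw [forall_pos_exists_hasOnlyRealZeros_iteratedDeriv_iff_iInf_eq_zero]
  constructor
  · intro h
    simpa [h] using tendsto_kiKimLee_const
  · intro h
    exact tendsto_nhds_unique tendsto_kiKimLee_const h

/-- **Ki–Kim–Lee (ii) ⟺ its uniform form**: for every `ε > 0`, ALL derivatives of high enough order are
hyperbolic at EVERY time `t ≥ ε` (up-set in `t`, G6.10, and heredity in `m`, G6.6). -/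
theorem forall_pos_exists_hasOnlyRealZeros_iteratedDeriv_iff_eventually_uniform :
    (∀ t : ℝ, 0 < t → ∃ m : ℕ, HasOnlyRealZeros (iteratedDeriv m (deBruijnH t))) ↔
      ∀ ε : ℝ, 0 < ε → ∃ m₀ : ℕ, ∀ m : ℕ, m₀ ≤ m → ∀ t : ℝ, ε ≤ t →
        HasOnlyRealZeros (iteratedDeriv m (deBruijnH t)) := by
  constructor
  · intro h ε hε
    obtain ⟨m₀, hm₀⟩ := h ε hε
    refine ⟨m₀, fun m hm t ht ↦ ?_⟩
    exact hasOnlyRealZeros_iteratedDeriv_mono_t m ht (hasOnlyRealZeros_iteratedDeriv_mono ε hm hm₀)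
  · intro h t ht
    obtain ⟨m₀, hm₀⟩ := h t ht
    exact ⟨m₀, hm₀ m₀ le_rfl t le_rfl⟩

/-- RH implies Ki–Kim–Lee (ii) trivially (every derivative of `H_t` is hyperbolic for every `t ≥ 0`). -/
theorem forall_pos_exists_hasOnlyRealZeros_iteratedDeriv_of_rh (hRH : _root_.RiemannHypothesis) :
    ∀ t : ℝ, 0 < t → ∃ m : ℕ, HasOnlyRealZeros (iteratedDeriv m (deBruijnH t)) :=
  (forall_pos_exists_hasOnlyRealZeros_iteratedDeriv_iff_iInf_eq_zero).2
    (iInf_kiKimLee_const_eq_zero_of_rh hRH)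

/-- **Neg-lens reading of Ki–Kim–Lee (ii)**: granted (ii), a failure of the A-type rung `A_k`
(`λ_k > 0`) is washed out by differentiation — for every margin `ε > 0` all rungs of high enough
order hold at time `ε`, although (Newman for derivatives, G6.2) none ever holds at a time `t < 0`. -/
theorem eventually_hasOnlyRealZeros_iteratedDeriv_of_kiKimLee
    (hKKL : ∀ t : ℝ, 0 < t → ∃ m : ℕ, HasOnlyRealZeros (iteratedDeriv m (deBruijnH t)))
    (ε : ℝ) (hε : 0 < ε) :
    (∀ᶠ m : ℕ in atTop, HasOnlyRealZeros (iteratedDeriv m (deBruijnH ε))) ∧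
      ∀ m : ℕ, ¬ HasOnlyRealZeros (iteratedDeriv m (deBruijnH (-ε))) := by
  obtain ⟨m₀, hm₀⟩ :=
    (forall_pos_exists_hasOnlyRealZeros_iteratedDeriv_iff_eventually_uniform.1 hKKL) ε hε
  exact ⟨Filter.eventually_atTop.2 ⟨m₀, fun m hm ↦ hm₀ m hm ε le_rfl⟩,
    fun m ↦ newmanAllDeriv m (-ε) (by linarith)⟩

end Limit

end Summit.RiemannHypothesis.RiemannHypothesis.Theorems.Splittings.JensenX4NewmanAllDeriv

end
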